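import Mathlib
import Literature.Analysis.FluidPDE.SubMeanValue
import Literature.Analysis.FluidPDE.SelfSimilarEulerProfilePressureLaplacian
import HarnessLib

/-!
# «PRESSURE SPIKES SIT NEXT TO GRADIENT SPIKES» — the sub-mean-value inequality at pressurised points of a class profile
# (crux `EulerZoomLiouville.PowerGaugeEulerLiouville` = stmt-NavierStokesRegularity-19832, THE ONE STATEMENT; LEAD ns-typeII-p2 g12
# RESIDUE-MEMO-19832-g12 §4 (A2) / §5 / T2, width seat ns-ezl-w1 g4)

Route №10 `EulerZoomLiouville` (NavierStokesRegularity).  The surviving needles of THE ONE STATEMENT carry PRESSURISED far points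
(`P′(y) ≳ ‖y‖²` on the vortical Bernoulli-high set, memo §1 (N2)/(N3), §2 T2).  The profile pressure solves
`ΔP′ = |curl V|² − |DV|²_F ≥ −3‖DV‖²` (`Literature/…/SelfSimilarEulerProfilePressureLaplacian`), so `P′` is SUBHARMONIC UP TO THE
ENSTROPHY DENSITY and the sub-mean-value inequality with defect (`Literature/…/SubMeanValue`) bounds the EXCESS of `P′(x₀)` over its
`probeBump R`-average by `∫₀¹ s ∫ Q(y) · 3‖DV(x₀ + s y)‖² dy ds`.  Here, quantitatively on `ℝ³`:
* `defect_inner_le_near` / `defect_inner_le_far` — the inner integral `∫ Q(y) f(x₀ + s y) dy` is bounded by the NEAR supremum of `f`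
  (small `s`) and, after `z = s y` (`Measure.integral_comp_smul`), by `s⁻³ · sup Q · ∫_{B_{2R}(x₀)} f` (large `s`);
* **`defect_le_two_scale`** — `∫₀¹ s∫ Q f(x₀+s·) ≤ 4 v₁ B R δ² A + (B R/δ) ∫_{B_{2R}(x₀)} f` for `0 ≤ Q ≤ B` vanishing off `‖y‖ < 2R`,
  `f ≥ 0`, `0 < δ ≤ R`, `f ≤ A` on `B̄_{2δ}(x₀)` (`v₁ = vol B₁`; split at `s₀ = δ/R`): the truncated Newtonian potential of `f` at `x₀`
  read at two scales;
* **`pressure_excess_le_two_scale`** — ANY `C²` self-similar Euler profile `(V, P′)` on `ℝ³` (any `γ`, any centre), `0 < δ ≤ R`,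
  `‖DV‖² ≤ a` on `B̄_{2δ}(x₀)`:  `P′(x₀) ≤ ∫ χ_R(y) P′(x₀+y) dy + (24 v₁/m) δ² a + (6/(m δ)) ∫_{B_{2R}(x₀)} ‖DV‖²`  (`m = baseBumpMass`);
* **`exists_gradient_spike_near_pressure_excess`** — CLASS FORM: with the `E`-gauge growth `∫_{B_L} ‖DV‖² ≤ c_E L^{1−ρ}`, a point
  `x₀ ∈ B̄_L` (`L ≥ 1`) whose pressure exceeds its `χ_R`-average by `κL²` (`R ≤ L`) has, for every `δ ∈ (0, R]` with
  `12 c_E (3L)^{1−ρ} ≤ m κ L² δ` (`δ ≳ c_E L^{−1−ρ}/κ`), a point `z ∈ B̄_{2δ}(x₀)` with `‖DV(z)‖² ≥ m κ L²/(48 v₁ δ²)` — at the smallest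
  admissible `δ` a GRADIENT SPIKE `‖DV‖ ≳ κ^{3/2} L^{2+ρ}/c_E` within `≲ c_E L^{−1−ρ}/κ` of EVERY such pressurised point (memo §4 (A2)).
The curve/orbit («parking») form needs the kernel version of the defect and is NOT here.

HONEST LABEL: tool + portrait stratum; nothing here excludes a needle.  WHAT THIS IS NOT: not NS, not E — `--supports` stmt-19832 on
the MODEL lattice; 19832 OPEN; NS regularity NOT proved. [folklore; GilbargTrudinger2001 Thm 2.1; ConstantinIgnatovaVicol2026Putative
§3.1.1 (3.3)]
-/

noncomputable section

-- flat `Theorems/<Route><Decl>…` files of one crux share the namespace of the crux (tree convention)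
set_option linter.dupNamespace false

open MeasureTheory Set Filter Topology Metric Function InnerProductSpace
open scoped RealInnerProductSpace NNReal ENNReal Laplacian

namespace Summit.NavierStokesRegularity.NavierStokesRegularity.Theorems.PowerGaugeEulerLiouville.PressureParking

open Literature.Analysis Literature.Analysis.FluidPDE

/-! ### Plumbing on `ℝ³` -/

/-- The volume of a ball of radius `r > 0` in `ℝ³` is `r³ v₁`, `v₁ = vol B₁`. [folklore] -/
theorem volume_ball_toReal {r : ℝ} (hr : 0 < r) (x : EuclideanSpace ℝ (Fin 3)) :
    (volume (ball x r)).toReal = r ^ 3 * (volume (ball (0 : EuclideanSpace ℝ (Fin 3)) 1)).toReal := by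
  rw [Measure.addHaar_ball_of_pos volume x hr, finrank_euclideanSpace_fin, ENNReal.toReal_mul,
    ENNReal.toReal_ofReal (pow_nonneg hr.le 3)]

/-- A function vanishing off the open ball `‖y‖ < ρ` has compact support. [folklore] -/
theorem hasCompactSupport_of_eq_zero_of_le_norm {Q : EuclideanSpace ℝ (Fin 3) → ℝ} {ρ : ℝ}
    (hQz : ∀ y, ρ ≤ ‖y‖ → Q y = 0) : HasCompactSupport Q :=
  HasCompactSupport.intro (isCompact_closedBall (0 : EuclideanSpace ℝ (Fin 3)) ρ) fun y hy => by
    rw [mem_closedBall_zero_iff, not_le] at hy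
    exact hQz y hy.le

/-- Continuity of `s ↦ ∫ Q(y) g(x₀ + s y) dy` for `Q` continuous of compact support and `g` continuous (Mathlib's
`continuous_parametric_integral_of_continuous` on `tsupport Q`). [folklore] -/
theorem continuous_integral_mul_comp_add_smul {Q g : EuclideanSpace ℝ (Fin 3) → ℝ} (hQ : Continuous Q)
    (hQc : HasCompactSupport Q) (hg : Continuous g) (x₀ : EuclideanSpace ℝ (Fin 3)) :
    Continuous fun s : ℝ => ∫ y, Q y * g (x₀ + s • y) := by
  set F : ℝ → EuclideanSpace ℝ (Fin 3) → ℝ := fun s y => Q y * g (x₀ + s • y) with hF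
  have hFc : Continuous (uncurry F) :=
    (hQ.comp continuous_snd).mul (hg.comp (continuous_const.add (continuous_fst.smul continuous_snd)))
  have h : (fun s => ∫ y, F s y) = fun s => ∫ y in tsupport Q, F s y := by
    funext s
    refine (setIntegral_eq_integral_of_forall_compl_eq_zero fun y hy => ?_).symm
    simp [hF, image_eq_zero_of_notMem_tsupport hy]
  show Continuous fun s => ∫ y, F s y
  rw [h]
  exact continuous_parametric_integral_of_continuous hFc hQc

/-- Translation of a ball integral: `∫_{B_r(0)} f(x₀ + z) dz = ∫_{B_r(x₀)} f`. [folklore] -/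
theorem setIntegral_ball_comp_add (f : EuclideanSpace ℝ (Fin 3) → ℝ) (x₀ : EuclideanSpace ℝ (Fin 3)) (r : ℝ) :
    ∫ z in ball (0 : EuclideanSpace ℝ (Fin 3)) r, f (x₀ + z) = ∫ z in ball x₀ r, f z := by
  rw [← integral_indicator measurableSet_ball, ← integral_indicator measurableSet_ball]
  have h : (ball (0 : EuclideanSpace ℝ (Fin 3)) r).indicator (fun z => f (x₀ + z)) =
      fun z => (ball x₀ r).indicator f (x₀ + z) := by
    funext z
    by_cases hz : z ∈ ball (0 : EuclideanSpace ℝ (Fin 3)) r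
    · have hz' : x₀ + z ∈ ball x₀ r := by
        rw [mem_ball_zero_iff] at hz
        rwa [mem_ball, dist_eq_norm, add_sub_cancel_left]
      rw [indicator_of_mem hz, indicator_of_mem hz']
    · have hz' : x₀ + z ∉ ball x₀ r := by
        rw [mem_ball_zero_iff] at hz
        rwa [mem_ball, dist_eq_norm, add_sub_cancel_left]
      rw [indicator_of_notMem hz, indicator_of_notMem hz']
  rw [h]
  exact integral_add_left_eq_self _ x₀

/-! ### The two bounds of the inner integral `∫ Q(y) f(x₀ + s y) dy` -/

section Inner
variable {Q f : EuclideanSpace ℝ (Fin 3) → ℝ} {B R : ℝ} {x₀ : EuclideanSpace ℝ (Fin 3)}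

/-- **Near bound.**  If `0 ≤ Q ≤ B` vanishes off `‖y‖ < 2R`, `0 ≤ f ≤ A` on `B̄_{2δ}(x₀)` and `0 ≤ s ≤ δ/R`, then
`∫ Q(y) f(x₀ + s y) dy ≤ 8 v₁ R³ B A` (for `‖y‖ < 2R`, `‖s y‖ ≤ 2δ`). [folklore] -/
theorem defect_inner_le_near (hQ : Continuous Q) (hQ0 : ∀ y, 0 ≤ Q y) (hQB : ∀ y, Q y ≤ B) (hR : 0 < R)
    (hQz : ∀ y, 2 * R ≤ ‖y‖ → Q y = 0) (hf : Continuous f) (hf0 : ∀ z, 0 ≤ f z) {δ A : ℝ} (hδ : 0 < δ)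
    (hA : ∀ z ∈ closedBall x₀ (2 * δ), f z ≤ A) {s : ℝ} (hs0 : 0 ≤ s) (hs : s ≤ δ / R) :
    ∫ y, Q y * f (x₀ + s • y) ≤
      8 * (volume (ball (0 : EuclideanSpace ℝ (Fin 3)) 1)).toReal * R ^ 3 * B * A := by
  have hA0 : 0 ≤ A := (hf0 x₀).trans (hA x₀ (mem_closedBall_self (by positivity)))
  have hB0 : 0 ≤ B := (hQ0 0).trans (hQB 0)
  have hQc : HasCompactSupport Q := hasCompactSupport_of_eq_zero_of_le_norm hQz
  -- pointwise: `Q y f(x₀ + s y) ≤ B A 𝟙_{B_{2R}}(y)`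
  have hpt : ∀ y, Q y * f (x₀ + s • y) ≤
      (ball (0 : EuclideanSpace ℝ (Fin 3)) (2 * R)).indicator (fun _ => B * A) y := by
    intro y
    by_cases hy : ‖y‖ < 2 * R
    · rw [indicator_of_mem (mem_ball_zero_iff.2 hy)]
      have hz : x₀ + s • y ∈ closedBall x₀ (2 * δ) := by
        rw [mem_closedBall, dist_eq_norm, add_sub_cancel_left, norm_smul, Real.norm_eq_abs, abs_of_nonneg hs0]
        calc s * ‖y‖ ≤ (δ / R) * (2 * R) := mul_le_mul hs hy.le (norm_nonneg _) (by positivity)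
          _ = 2 * δ := by field_simp
      exact mul_le_mul (hQB y) (hA _ hz) (hf0 _) hB0
    · rw [hQz y (not_lt.1 hy), zero_mul, indicator_of_notMem (by rwa [mem_ball_zero_iff])]
  have hint : Integrable (fun y => Q y * f (x₀ + s • y)) :=
    (hQ.mul (hf.comp (continuous_const.add (continuous_const_smul s)))).integrable_of_hasCompactSupport
      (hQc.mul_right (f' := fun y => f (x₀ + s • y)))
  have hind : Integrable ((ball (0 : EuclideanSpace ℝ (Fin 3)) (2 * R)).indicator fun _ => B * A) := by
    refine IntegrableOn.integrable_indicator ?_ measurableSet_ball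
    exact (integrableOn_const_iff (C := B * A)).2 (Or.inr measure_ball_lt_top)
  calc ∫ y, Q y * f (x₀ + s • y)
      ≤ ∫ y, (ball (0 : EuclideanSpace ℝ (Fin 3)) (2 * R)).indicator (fun _ => B * A) y := integral_mono hint hind hpt
    _ = (volume (ball (0 : EuclideanSpace ℝ (Fin 3)) (2 * R))).toReal * (B * A) := by
        rw [integral_indicator measurableSet_ball, setIntegral_const, smul_eq_mul, measureReal_def]
    _ = 8 * (volume (ball (0 : EuclideanSpace ℝ (Fin 3)) 1)).toReal * R ^ 3 * B * A := by
        rw [volume_ball_toReal (by positivity)]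
        ring

/-- **Far bound.**  If `0 ≤ Q ≤ B` vanishes off `‖y‖ < 2R`, `f ≥ 0` and `0 < s ≤ 1`, then after `z = s y`
(`Measure.integral_comp_smul`): `∫ Q(y) f(x₀ + s y) dy = s⁻³ ∫ Q(z/s) f(x₀ + z) dz ≤ s⁻³ B ∫_{B_{2R}(x₀)} f`. [folklore] -/
theorem defect_inner_le_far (hQ : Continuous Q) (hQB : ∀ y, Q y ≤ B)
    (hQz : ∀ y, 2 * R ≤ ‖y‖ → Q y = 0) (hf : Continuous f) (hf0 : ∀ z, 0 ≤ f z)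
    {s : ℝ} (hs0 : 0 < s) (hs1 : s ≤ 1) :
    ∫ y, Q y * f (x₀ + s • y) ≤ (s ^ 3)⁻¹ * B * ∫ z in ball x₀ (2 * R), f z := by
  have hQc : HasCompactSupport Q := hasCompactSupport_of_eq_zero_of_le_norm hQz
  set g : EuclideanSpace ℝ (Fin 3) → ℝ := fun z => Q (s⁻¹ • z) * f (x₀ + z) with hgdef
  have hg : (fun y => Q y * f (x₀ + s • y)) = fun y => g (s • y) := by
    funext y
    simp only [hgdef, inv_smul_smul₀ hs0.ne']
  have hsub := Measure.integral_comp_smul volume g s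
  rw [finrank_euclideanSpace_fin, abs_of_nonneg (by positivity : (0 : ℝ) ≤ (s ^ 3)⁻¹), smul_eq_mul] at hsub
  rw [hg, hsub]
  -- `g ≤ B 𝟙_{B_{2R}} f(x₀ + ·)`
  have hpt : ∀ z, g z ≤ (ball (0 : EuclideanSpace ℝ (Fin 3)) (2 * R)).indicator (fun z => B * f (x₀ + z)) z := by
    intro z
    by_cases hz : ‖z‖ < 2 * R
    · rw [indicator_of_mem (mem_ball_zero_iff.2 hz)]
      exact mul_le_mul_of_nonneg_right (hQB _) (hf0 _)
    · have h2 : 2 * R ≤ ‖s⁻¹ • z‖ := by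
        rw [norm_smul, norm_inv, Real.norm_eq_abs, abs_of_pos hs0]
        calc 2 * R ≤ ‖z‖ := not_lt.1 hz
          _ ≤ s⁻¹ * ‖z‖ := le_mul_of_one_le_left (norm_nonneg _) ((one_le_inv₀ hs0).2 hs1)
      rw [indicator_of_notMem (show z ∉ ball (0 : EuclideanSpace ℝ (Fin 3)) (2 * R) by
        rwa [mem_ball_zero_iff])]
      simp [hgdef, hQz _ h2]
  have hgi : Integrable g :=
    ((hQ.comp (continuous_const_smul s⁻¹)).mul (hf.comp (continuous_const.add continuous_id))).integrable_of_hasCompactSupport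
      ((hQc.comp_smul (inv_ne_zero hs0.ne')).mul_right (f' := fun z => f (x₀ + z)))
  have hfi : IntegrableOn (fun z => B * f (x₀ + z)) (ball (0 : EuclideanSpace ℝ (Fin 3)) (2 * R)) :=
    ((continuous_const.mul (hf.comp (continuous_const.add continuous_id))).continuousOn.integrableOn_compact
      (isCompact_closedBall (0 : EuclideanSpace ℝ (Fin 3)) (2 * R))).mono_set ball_subset_closedBall
  have hind : Integrable ((ball (0 : EuclideanSpace ℝ (Fin 3)) (2 * R)).indicator fun z => B * f (x₀ + z)) :=
    hfi.integrable_indicator measurableSet_ball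
  calc (s ^ 3)⁻¹ * ∫ z, g z
      ≤ (s ^ 3)⁻¹ * ∫ z, (ball (0 : EuclideanSpace ℝ (Fin 3)) (2 * R)).indicator (fun z => B * f (x₀ + z)) z :=
        mul_le_mul_of_nonneg_left (integral_mono hgi hind hpt) (by positivity)
    _ = (s ^ 3)⁻¹ * B * ∫ z in ball x₀ (2 * R), f z := by
        rw [integral_indicator measurableSet_ball, integral_const_mul, setIntegral_ball_comp_add]
        ring

/-! ### The two-scale bound of the defect -/

/-- **THE TWO-SCALE BOUND OF THE MEAN VALUE DEFECT** on `ℝ³`.  For `0 ≤ Q ≤ B` continuous vanishing off `‖y‖ < 2R`, `f ≥ 0`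
continuous, `0 < δ ≤ R` and `f ≤ A` on `B̄_{2δ}(x₀)`:
`∫₀¹ s ∫ Q(y) f(x₀ + s y) dy ds ≤ 4 v₁ B R δ² A + (B R/δ) ∫_{B_{2R}(x₀)} f` — split the `s`-integral at `s₀ = δ/R`: near bound
on `[0, s₀]` (`∫₀^{s₀} s = s₀²/2`), far bound on `[s₀, 1]` (`∫_{s₀}^1 s·s⁻³ = s₀⁻¹ − 1 ≤ R/δ`). [folklore] -/
theorem defect_le_two_scale (hQ : Continuous Q) (hQ0 : ∀ y, 0 ≤ Q y) (hQB : ∀ y, Q y ≤ B) (hR : 0 < R)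
    (hQz : ∀ y, 2 * R ≤ ‖y‖ → Q y = 0) (hf : Continuous f) (hf0 : ∀ z, 0 ≤ f z) (x₀ : EuclideanSpace ℝ (Fin 3))
    {δ A : ℝ} (hδ : 0 < δ) (hδR : δ ≤ R) (hA : ∀ z ∈ closedBall x₀ (2 * δ), f z ≤ A) :
    ∫ s in (0 : ℝ)..1, s * ∫ y, Q y * f (x₀ + s • y) ≤
      4 * (volume (ball (0 : EuclideanSpace ℝ (Fin 3)) 1)).toReal * B * R * δ ^ 2 * A +
        B * R / δ * ∫ z in ball x₀ (2 * R), f z := by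
  set v₁ : ℝ := (volume (ball (0 : EuclideanSpace ℝ (Fin 3)) 1)).toReal with hv₁
  set G : ℝ → ℝ := fun s => ∫ y, Q y * f (x₀ + s • y) with hG
  set F : ℝ := ∫ z in ball x₀ (2 * R), f z with hF
  set s₀ : ℝ := δ / R with hs₀def
  have hs₀ : 0 < s₀ := by positivity
  have hs₀1 : s₀ ≤ 1 := (div_le_one hR).2 hδR
  have hA0 : 0 ≤ A := (hf0 x₀).trans (hA x₀ (mem_closedBall_self (by positivity)))
  have hB0 : 0 ≤ B := (hQ0 0).trans (hQB 0)
  have hF0 : 0 ≤ F := setIntegral_nonneg measurableSet_ball fun z _ => hf0 z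
  have hQc : HasCompactSupport Q := hasCompactSupport_of_eq_zero_of_le_norm hQz
  have hGc : Continuous G := continuous_integral_mul_comp_add_smul hQ hQc hf x₀
  have hGi : ∀ a b : ℝ, IntervalIntegrable (fun s => s * G s) volume a b := fun a b =>
    (continuous_id.mul hGc).intervalIntegrable a b
  have hsplit : ∫ s in (0 : ℝ)..1, s * G s = (∫ s in (0 : ℝ)..s₀, s * G s) + ∫ s in s₀..1, s * G s :=
    (intervalIntegral.integral_add_adjacent_intervals (hGi 0 s₀) (hGi s₀ 1)).symm
  -- near piece
  have hnear : ∫ s in (0 : ℝ)..s₀, s * G s ≤ 4 * v₁ * B * R * δ ^ 2 * A := by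
    have h1 : ∫ s in (0 : ℝ)..s₀, s * G s ≤ ∫ s in (0 : ℝ)..s₀, s * (8 * v₁ * R ^ 3 * B * A) :=
      intervalIntegral.integral_mono_on hs₀.le (hGi 0 s₀)
        ((continuous_id.mul continuous_const).intervalIntegrable _ _)
        fun s hs => mul_le_mul_of_nonneg_left
          (defect_inner_le_near hQ hQ0 hQB hR hQz hf hf0 hδ hA hs.1 hs.2) hs.1
    have h2 : ∫ s in (0 : ℝ)..s₀, s * (8 * v₁ * R ^ 3 * B * A) = s₀ ^ 2 / 2 * (8 * v₁ * R ^ 3 * B * A) := by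
      rw [intervalIntegral.integral_mul_const, integral_id]
      ring
    have h3 : s₀ ^ 2 / 2 * (8 * v₁ * R ^ 3 * B * A) = 4 * v₁ * B * R * δ ^ 2 * A := by
      rw [hs₀def]
      field_simp
      ring
    linarith
  -- far piece
  have hfar : ∫ s in s₀..1, s * G s ≤ B * R / δ * F := by
    have hcont : ContinuousOn (fun s : ℝ => B * F * (s ^ 2)⁻¹) (uIcc s₀ 1) := by
      refine continuousOn_const.mul ((continuousOn_pow 2).inv₀ fun s hs => ?_)
      rw [uIcc_of_le hs₀1] at hs
      exact pow_ne_zero 2 (hs₀.trans_le hs.1).ne'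
    have h1 : ∫ s in s₀..1, s * G s ≤ ∫ s in s₀..1, B * F * (s ^ 2)⁻¹ := by
      refine intervalIntegral.integral_mono_on hs₀1 (hGi s₀ 1) hcont.intervalIntegrable fun s hs => ?_
      have hs0 : 0 < s := hs₀.trans_le hs.1
      have hin : G s ≤ (s ^ 3)⁻¹ * B * F := defect_inner_le_far hQ hQB hQz hf hf0 hs0 hs.2
      calc s * G s ≤ s * ((s ^ 3)⁻¹ * B * F) := mul_le_mul_of_nonneg_left hin hs0.le
        _ = B * F * (s ^ 2)⁻¹ := by
            field_simp
    have h2 : ∫ s in s₀..1, B * F * (s ^ 2)⁻¹ = B * F * (s₀⁻¹ - 1) := by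
      rw [intervalIntegral.integral_const_mul]
      have hderiv : ∀ s ∈ uIcc s₀ 1, HasDerivAt (fun s : ℝ => -s⁻¹) ((s ^ 2)⁻¹) s := by
        intro s hs
        rw [uIcc_of_le hs₀1] at hs
        have hs0 : s ≠ 0 := (hs₀.trans_le hs.1).ne'
        have h := (hasDerivAt_inv hs0).neg
        simp only [neg_neg] at h
        exact h
      have hcont' : ContinuousOn (fun s : ℝ => (s ^ 2)⁻¹) (uIcc s₀ 1) := by
        refine (continuousOn_pow 2).inv₀ fun s hs => ?_
        rw [uIcc_of_le hs₀1] at hs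
        exact pow_ne_zero 2 (hs₀.trans_le hs.1).ne'
      rw [intervalIntegral.integral_eq_sub_of_hasDerivAt hderiv hcont'.intervalIntegrable]
      simp only [inv_one]
      ring
    have h3 : B * F * (s₀⁻¹ - 1) ≤ B * R / δ * F := by
      have hinv : s₀⁻¹ = R / δ := by rw [hs₀def, inv_div]
      rw [hinv]
      have hexp : B * F * (R / δ - 1) = B * R / δ * F - B * F := by ring
      rw [hexp]
      linarith [mul_nonneg hB0 hF0]
    linarith
  show ∫ s in (0 : ℝ)..1, s * G s ≤ 4 * v₁ * B * R * δ ^ 2 * A + B * R / δ * F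
  rw [hsplit]
  linarith

end Inner

/-! ### Profiles: the pressure excess at a point is carried by the enstrophy at two scales -/

/-- **THE PRESSURE EXCESS OF A PROFILE IS CARRIED BY THE ENSTROPHY AT TWO SCALES.**  Let `(V, P′)` be a `C²` self-similar Euler
profile on `ℝ³` (any `γ`, any centre), `x₀ ∈ ℝ³`, `0 < δ ≤ R`, and `‖DV‖² ≤ a` on `B̄_{2δ}(x₀)`.  Then
`P′(x₀) ≤ ∫ χ_R(y) P′(x₀ + y) dy + (24 v₁/m) δ² a + (6/(m δ)) ∫_{B_{2R}(x₀)} ‖DV‖²`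
(`χ_R = probeBump R` the unit-mass radial bump, `m = baseBumpMass ℝ³`, `v₁ = vol B₁`): the sub-mean-value inequality with defect
for `ΔP′ ≥ −3‖DV‖²` and the two-scale bound. [folklore; GilbargTrudinger2001 Thm 2.1] -/
theorem pressure_excess_le_two_scale {γ : ℝ} {c : EuclideanSpace ℝ (Fin 3)}
    {V : EuclideanSpace ℝ (Fin 3) → EuclideanSpace ℝ (Fin 3)} {P' : EuclideanSpace ℝ (Fin 3) → ℝ}
    (hprof : IsSelfSimilarEulerProfile γ c V P') (x₀ : EuclideanSpace ℝ (Fin 3)) {R δ a : ℝ} (hδ : 0 < δ)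
    (hδR : δ ≤ R) (ha : ∀ z ∈ closedBall x₀ (2 * δ), ‖fderiv ℝ V z‖ ^ 2 ≤ a) :
    P' x₀ ≤ (∫ y, probeBump R y * P' (x₀ + y)) +
      (24 * (volume (ball (0 : EuclideanSpace ℝ (Fin 3)) 1)).toReal / baseBumpMass (EuclideanSpace ℝ (Fin 3)) * δ ^ 2 * a +
        6 / (baseBumpMass (EuclideanSpace ℝ (Fin 3)) * δ) * ∫ z in ball x₀ (2 * R), ‖fderiv ℝ V z‖ ^ 2) := by
  have hR : 0 < R := hδ.trans_le hδR
  have hm : 0 < baseBumpMass (EuclideanSpace ℝ (Fin 3)) := baseBumpMass_pos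
  set f : EuclideanSpace ℝ (Fin 3) → ℝ := fun z => 3 * ‖fderiv ℝ V z‖ ^ 2 with hfdef
  have hDVc : Continuous fun z => ‖fderiv ℝ V z‖ ^ 2 :=
    (hprof.contDiff_velocity.continuous_fderiv (by simp)).norm.pow 2
  have hf : Continuous f := continuous_const.mul hDVc
  have hf0 : ∀ z, 0 ≤ f z := fun z => by positivity
  have hΔ : ∀ x, -f x ≤ (Δ P') x := fun x => by
    simpa [hfdef] using hprof.neg_three_mul_sq_opNorm_fderiv_le_laplacian_pressure x
  obtain ⟨Q, hQ, hQ0, hQz, hQB, hmv⟩ :=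
    le_integral_probeBump_mul_comp_add_add hprof.contDiff_two_pressure hf hΔ hR
  have hA : ∀ z ∈ closedBall x₀ (2 * δ), f z ≤ 3 * a := fun z hz => by
    simp only [hfdef]
    linarith [ha z hz]
  have hD := defect_le_two_scale hQ hQ0 hQB hR hQz hf hf0 x₀ hδ hδR hA
  have hI : ∫ z in ball x₀ (2 * R), f z = 3 * ∫ z in ball x₀ (2 * R), ‖fderiv ℝ V z‖ ^ 2 := by
    simp only [hfdef]
    exact integral_const_mul _ _
  rw [finrank_euclideanSpace_fin, hI] at hD
  have halg : 4 * (volume (ball (0 : EuclideanSpace ℝ (Fin 3)) 1)).toReal *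
        (2 * R ^ 2 * (baseBumpMass (EuclideanSpace ℝ (Fin 3)) * R ^ 3)⁻¹) * R * δ ^ 2 * (3 * a) +
      2 * R ^ 2 * (baseBumpMass (EuclideanSpace ℝ (Fin 3)) * R ^ 3)⁻¹ * R / δ *
        (3 * ∫ z in ball x₀ (2 * R), ‖fderiv ℝ V z‖ ^ 2) =
      24 * (volume (ball (0 : EuclideanSpace ℝ (Fin 3)) 1)).toReal / baseBumpMass (EuclideanSpace ℝ (Fin 3)) * δ ^ 2 * a +
        6 / (baseBumpMass (EuclideanSpace ℝ (Fin 3)) * δ) * ∫ z in ball x₀ (2 * R), ‖fderiv ℝ V z‖ ^ 2 := by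
    field_simp
    ring
  linarith [hmv x₀]

/-! ### Class form: pressure spikes sit next to gradient spikes -/

/-- The real enstrophy of a `C¹` field on a ball inside `B_{L'}(0)` is controlled by the class `E`-datum at scale `L'`:
`∫_{B_{2R}(x₀)} ‖DV‖² ≤ c_E L'^{1−ρ}` when `B_{2R}(x₀) ⊆ B_{L'}(0)`. [folklore] -/
theorem setIntegral_sq_norm_fderiv_le_of_gauge {ρ : ℝ} {V : EuclideanSpace ℝ (Fin 3) → EuclideanSpace ℝ (Fin 3)}
    (hV : ContDiff ℝ 1 V) {cE : ℝ} (hcE : 0 ≤ cE)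
    (hE : ∀ L : ℝ, 0 < L → ∫⁻ y in ball (0 : EuclideanSpace ℝ (Fin 3)) L, ‖fderiv ℝ V y‖ₑ ^ 2 ≤
      ENNReal.ofReal (cE * L ^ (1 - ρ)))
    {x₀ : EuclideanSpace ℝ (Fin 3)} {R L' : ℝ} (hL' : 0 < L') (hsub : ball x₀ (2 * R) ⊆ ball 0 L') :
    ∫ z in ball x₀ (2 * R), ‖fderiv ℝ V z‖ ^ 2 ≤ cE * L' ^ (1 - ρ) := by
  have hcont : Continuous fun z => ‖fderiv ℝ V z‖ ^ 2 := (hV.continuous_fderiv (by simp)).norm.pow 2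
  have hint : IntegrableOn (fun z => ‖fderiv ℝ V z‖ ^ 2) (ball (0 : EuclideanSpace ℝ (Fin 3)) L') :=
    (hcont.continuousOn.integrableOn_compact (isCompact_closedBall (0 : EuclideanSpace ℝ (Fin 3)) L')).mono_set
      ball_subset_closedBall
  have h1 : ∫ z in ball x₀ (2 * R), ‖fderiv ℝ V z‖ ^ 2 ≤ ∫ z in ball (0 : EuclideanSpace ℝ (Fin 3)) L', ‖fderiv ℝ V z‖ ^ 2 :=
    setIntegral_mono_set hint (ae_of_all _ fun z => sq_nonneg _) hsub.eventuallyLE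
  have h2 : ∫ z in ball (0 : EuclideanSpace ℝ (Fin 3)) L', ‖fderiv ℝ V z‖ ^ 2 ≤ cE * L' ^ (1 - ρ) := by
    rw [integral_eq_lintegral_of_nonneg_ae (ae_of_all _ fun z => sq_nonneg _)
      hcont.aestronglyMeasurable.restrict]
    refine ENNReal.toReal_le_of_le_ofReal (by positivity) ?_
    rw [← lintegral_enorm_sq_eq_lintegral_ofReal]
    exact hE L' hL'
  exact h1.trans h2

/-- **«PRESSURE SPIKES SIT NEXT TO GRADIENT SPIKES»** (class form, RESIDUE-MEMO-19832-g12 §4 (A2)/§5).  Let `(V, P′)` be a `C²`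
self-similar Euler profile on `ℝ³` (any `γ`, any centre) with the class `E`-gauge growth `∫_{B_L(0)} ‖DV‖² ≤ c_E L^{1−ρ}` (all
`L > 0`).  Let `L ≥ 1`, `x₀ ∈ B̄_L(0)`, `0 < δ ≤ R ≤ L`, and suppose the pressure at `x₀` EXCEEDS its `χ_R`-average by `κ L²`:
`κL² + ∫ χ_R(y) P′(x₀+y) dy ≤ P′(x₀)`.  If `δ` is admissible, `12 c_E (3L)^{1−ρ} ≤ m κ L² δ` (i.e. `δ ≳ c_E L^{−1−ρ}/κ`: the far
enstrophy term is at most `κL²/2`), then SOME point `z ∈ B̄_{2δ}(x₀)` has `‖DV(z)‖² ≥ m κ L²/(48 v₁ δ²)`.  At the smallest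
admissible `δ ≍ c_E L^{−1−ρ}/κ`: a gradient spike `‖DV‖ ≳ κ^{3/2} L^{2+ρ}/c_E` within `≲ c_E L^{−1−ρ}/κ` of every such pressurised point.
[folklore; GilbargTrudinger2001 Thm 2.1] -/
theorem exists_gradient_spike_near_pressure_excess {ρ γ : ℝ} {c : EuclideanSpace ℝ (Fin 3)}
    {V : EuclideanSpace ℝ (Fin 3) → EuclideanSpace ℝ (Fin 3)} {P' : EuclideanSpace ℝ (Fin 3) → ℝ}
    (hprof : IsSelfSimilarEulerProfile γ c V P') {cE : ℝ} (hcE : 0 ≤ cE)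
    (hE : ∀ L : ℝ, 0 < L → ∫⁻ y in ball (0 : EuclideanSpace ℝ (Fin 3)) L, ‖fderiv ℝ V y‖ₑ ^ 2 ≤
      ENNReal.ofReal (cE * L ^ (1 - ρ)))
    {L R κ δ : ℝ} (hL : 1 ≤ L) (hRL : R ≤ L) (hδ : 0 < δ) (hδR : δ ≤ R) {x₀ : EuclideanSpace ℝ (Fin 3)}
    (hx₀ : ‖x₀‖ ≤ L) (hexcess : κ * L ^ 2 + ∫ y, probeBump R y * P' (x₀ + y) ≤ P' x₀)
    (hδbig : 12 * cE * (3 * L) ^ (1 - ρ) ≤ baseBumpMass (EuclideanSpace ℝ (Fin 3)) * κ * L ^ 2 * δ) :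
    ∃ z ∈ closedBall x₀ (2 * δ),
      baseBumpMass (EuclideanSpace ℝ (Fin 3)) * κ * L ^ 2 /
          (48 * (volume (ball (0 : EuclideanSpace ℝ (Fin 3)) 1)).toReal * δ ^ 2) ≤ ‖fderiv ℝ V z‖ ^ 2 := by
  set m : ℝ := baseBumpMass (EuclideanSpace ℝ (Fin 3)) with hmdef
  set v₁ : ℝ := (volume (ball (0 : EuclideanSpace ℝ (Fin 3)) 1)).toReal with hv₁
  have hm : 0 < m := baseBumpMass_pos
  have hv : 0 < v₁ := ENNReal.toReal_pos (measure_ball_pos volume _ one_pos).ne' measure_ball_lt_top.ne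
  have hL0 : 0 < L := one_pos.trans_le hL
  -- the far enstrophy
  have hsub : ball x₀ (2 * R) ⊆ ball (0 : EuclideanSpace ℝ (Fin 3)) (3 * L) := fun z hz => by
    rw [mem_ball_zero_iff]
    rw [mem_ball, dist_eq_norm] at hz
    calc ‖z‖ = ‖(z - x₀) + x₀‖ := by rw [sub_add_cancel]
      _ ≤ ‖z - x₀‖ + ‖x₀‖ := norm_add_le _ _
      _ < 2 * R + L := add_lt_add_of_lt_of_le hz hx₀
      _ ≤ 3 * L := by linarith
  have hI := setIntegral_sq_norm_fderiv_le_of_gauge (hprof.contDiff_velocity.of_le (by norm_num)) hcE hE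
    (by positivity : (0 : ℝ) < 3 * L) hsub
  -- the maximum of `‖DV‖²` on the compact ball
  have hDVc : Continuous fun z => ‖fderiv ℝ V z‖ ^ 2 :=
    (hprof.contDiff_velocity.continuous_fderiv (by simp)).norm.pow 2
  obtain ⟨z₀, hz₀, hmax⟩ := (isCompact_closedBall x₀ (2 * δ)).exists_isMaxOn
    (nonempty_closedBall.2 (by positivity)) hDVc.continuousOn
  refine ⟨z₀, hz₀, ?_⟩
  by_contra hlt
  push Not at hlt
  have ha : ∀ z ∈ closedBall x₀ (2 * δ), ‖fderiv ℝ V z‖ ^ 2 ≤ ‖fderiv ℝ V z₀‖ ^ 2 := fun z hz => hmax hz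
  have h := pressure_excess_le_two_scale hprof x₀ hδ hδR ha
  -- near term `< κL²/2`
  have ht1 : 24 * v₁ / m * δ ^ 2 * ‖fderiv ℝ V z₀‖ ^ 2 < κ * L ^ 2 / 2 := by
    have hpos : 0 < 24 * v₁ / m * δ ^ 2 := by positivity
    have := mul_lt_mul_of_pos_left hlt hpos
    have heq : 24 * v₁ / m * δ ^ 2 * (m * κ * L ^ 2 / (48 * v₁ * δ ^ 2)) = κ * L ^ 2 / 2 := by
      field_simp
      ring
    linarith
  -- far term `≤ κL²/2`
  have ht2 : 6 / (m * δ) * ∫ z in ball x₀ (2 * R), ‖fderiv ℝ V z‖ ^ 2 ≤ κ * L ^ 2 / 2 := by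
    have h6 : 6 / (m * δ) * ∫ z in ball x₀ (2 * R), ‖fderiv ℝ V z‖ ^ 2 ≤ 6 / (m * δ) * (cE * (3 * L) ^ (1 - ρ)) :=
      mul_le_mul_of_nonneg_left hI (by positivity)
    have h7 : 6 / (m * δ) * (cE * (3 * L) ^ (1 - ρ)) ≤ κ * L ^ 2 / 2 := by
      rw [div_mul_eq_mul_div, div_le_iff₀ (by positivity)]
      nlinarith
    exact h6.trans h7
  linarith

end Summit.NavierStokesRegularity.NavierStokesRegularity.Theorems.PowerGaugeEulerLiouville.PressureParking

end
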